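import Summits.FinalStateConjecture.FinalStateConjecture.Theorems.EIHFluxBalanceInertialRecessionStubHigherOrderComp
import Summits.FinalStateConjecture.FinalStateConjecture.Theorems.EIHFluxBalanceInertialRecessionBoostCalculus
import Summits.FinalStateConjecture.FinalStateConjecture.Theorems.EIHFluxBalanceInertialRecessionStubRechartLeibniz

/-!
# Route EIHFluxBalance — `InertialRecession` (E′), line `SketchCleanExcision`, skeleton r13,
# stub `stub_higherOrderSlaving` (EF): the pure-boost frame of a non-rotating hole, to order three

Helper file for the crux `stmt-FinalStateConjecture-17403`
(`Summit.FinalStateConjecture.FinalStateConjecture.Theses.EIHFluxBalance.InertialRecession`, E′),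
registered stub `stub_higherOrderSlaving` (orders two and three of frozen-vacuum slaving).

For a NON-ROTATING hole (`a = 0`) slaving controls only the painted `4`-velocity `u = Λe₀`;
the Schwarzschild field is invisible to the rest of the frame. The representative frame whose
derivatives are controlled by those of `u` is the pure boost of the lab velocity `v = ũ/u⁰`
(composed with the time reflection if `u⁰ < 0`): `higherOrder_exists_boostFrame` gives a smooth
Lorentz path `Λ̃` painting the same Schwarzschild field
(`boostedKerrBilin_zero_spin_eq_boost_repr`, `…_eq_reflect_boost_repr`), with `Λ̃e₀ = u`, and
`‖Λ̃′‖ ≤ K‖u′‖`, `‖Λ̃″‖ ≤ K(‖u″‖ + ‖u′‖²)`, `‖Λ̃‴‖ ≤ K(‖u‴‖ + ‖u″‖‖u′‖ + ‖u′‖³)` at every time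
(`Λ̃ = Ξ ∘ u` for the smooth map `Ξ(w) = boost(w̃/w⁰)` and the chain rule to order three,
`higherOrder_norm_deriv_comp₃_le`, with uniform constants on the compact set of unit timelike
vectors with Lorentz factor `≤ γ`).

No definitions, no named facts, no `sorry`.
-/

set_option linter.dupNamespace false
set_option maxSynthPendingDepth 6
set_option synthInstance.maxHeartbeats 200000

noncomputable section

namespace Summit.FinalStateConjecture.FinalStateConjecture.Theorems.SublinearIsFree.Slaving

open scoped Topology ContDiff
open Filter Set Function Metric Literature.Geometry.Lorentzian
  Summit.FinalStateConjecture.FinalStateConjecture.Theorems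
  Summit.FinalStateConjecture.FinalStateConjecture.Theorems.SublinearIsFree.Rechart

/-! ### The time reflection as a Lorentz transformation -/

/-- **The time reflection as an element of the Lorentz group**, acting by `w ↦ w − 2w⁰e₀`.
[folklore] -/
theorem higherOrder_exists_timeReflect : ∃ T : lorentzGroup,
    ∀ w : E4, (T : E4 ≃L[ℝ] E4) w = w - (2 * w 0) • E4.basisVector 0 := by
  -- the reflection preserves `η` and is an involution
  have hiso : ∀ v w : E4, Minkowski.bilin (v - (2 * v 0) • E4.basisVector 0)
      (w - (2 * w 0) • E4.basisVector 0) = Minkowski.bilin v w := fun v w ↦ by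
    simp only [Minkowski.bilin_apply, PseudotensorBound.reflect_apply, Fin.succ_ne_zero, if_true,
      if_false]
    ring
  have hinv : ∀ w : E4, (w - (2 * w 0) • E4.basisVector 0) -
      (2 * (w - (2 * w 0) • E4.basisVector 0) 0) • E4.basisVector 0 = w := fun w ↦ by
    have h0 : (w - (2 * w 0) • E4.basisVector 0) 0 = -w 0 := by
      rw [PseudotensorBound.reflect_apply]; simp
    rw [h0]
    ext μ
    simp only [PiLp.sub_apply, PiLp.smul_apply, smul_eq_mul]
    ring
  set R : E4 →L[ℝ] E4 := ContinuousLinearMap.id ℝ E4 -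
    (2 : ℝ) • (ContinuousLinearMap.smulRight (EuclideanSpace.proj (0 : Fin 4)) (E4.basisVector 0))
    with hR
  have hRapp : ∀ w : E4, R w = w - (2 * w 0) • E4.basisVector 0 := fun w ↦ by
    simp [hR, mul_smul]
  set Re : E4 ≃L[ℝ] E4 := ContinuousLinearEquiv.equivOfInverse R R
    (fun w ↦ by rw [hRapp, hRapp, hinv])
    (fun w ↦ by rw [hRapp, hRapp, hinv]) with hRe
  refine ⟨⟨Re, fun v w ↦ ?_⟩, fun w ↦ hRapp w⟩
  show Minkowski.bilin (R v) (R w) = Minkowski.bilin v w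
  rw [hRapp, hRapp, hiso]

/-! ### The compact set of unit timelike vectors with bounded Lorentz factor -/

/-- For a unit timelike vector (`η(w,w) = −1`): `(w⁰)² = 1 + ‖w̃‖²`, hence `w⁰ ≠ 0` and the lab
velocity has norm `< 1`; with `|w⁰| ≤ γ` also `‖w‖ ≤ 2γ`. [folklore] -/
theorem higherOrder_unitTimelike_facts {w : E4} (hw : Minkowski.bilin w w = -1) :
    w 0 ^ 2 = 1 + E4.spatialNorm w ^ 2 ∧ w 0 ≠ 0 ∧ ‖(w 0)⁻¹ • E4.spatial w‖ < 1 := by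
  have h1 : w 0 ^ 2 = 1 + E4.spatialNorm w ^ 2 := by
    rw [minkowski_bilin_self] at hw; linarith
  have h2 : w 0 ≠ 0 := fun h ↦ by
    rw [h] at h1; nlinarith [sq_nonneg (E4.spatialNorm w)]
  refine ⟨h1, h2, ?_⟩
  rw [norm_smul, norm_inv, Real.norm_eq_abs]
  have h3 : ‖E4.spatial w‖ < |w 0| := by
    have hsn : E4.spatialNorm w = ‖E4.spatial w‖ := rfl
    rw [← hsn]
    have h5 : E4.spatialNorm w ^ 2 < |w 0| ^ 2 := by rw [sq_abs]; linarith
    exact (pow_lt_pow_iff_left₀ (E4.spatialNorm_nonneg w) (abs_nonneg _) two_ne_zero).1 h5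
  have h4 : 0 < |w 0| := abs_pos.2 h2
  rw [inv_mul_lt_iff₀ h4, mul_one]
  exact h3

/-- **The set of unit timelike vectors with Lorentz factor `≤ γ` is compact.** [folklore] -/
theorem higherOrder_isCompact_unitTimelike (γ : ℝ) :
    IsCompact {w : E4 | Minkowski.bilin w w = -1 ∧ |w 0| ≤ γ} := by
  have hc1 : Continuous fun w : E4 ↦ Minkowski.bilin w w :=
    (Minkowski.bilin : E4 →L[ℝ] E4 →L[ℝ] ℝ).continuous₂.comp (continuous_id.prodMk continuous_id)
  have hc2 : Continuous fun w : E4 ↦ |w 0| :=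
    continuous_abs.comp (EuclideanSpace.proj (0 : Fin 4)).continuous
  have hcl : IsClosed {w : E4 | Minkowski.bilin w w = -1 ∧ |w 0| ≤ γ} :=
    (isClosed_eq hc1 continuous_const).inter (isClosed_le hc2 continuous_const)
  refine Metric.isCompact_of_isClosed_isBounded hcl ?_
  refine (Metric.isBounded_closedBall (x := (0 : E4)) (r := 2 * |γ|)).subset fun w hw ↦ ?_
  obtain ⟨h1, -, -⟩ := higherOrder_unitTimelike_facts hw.1
  rw [mem_closedBall, dist_zero_right]
  have hn := norm_sq_eq_sq_add_spatialNorm_sq w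
  have hγ : |w 0| ≤ |γ| := hw.2.trans (le_abs_self γ)
  have h2 : ‖w‖ ^ 2 ≤ (2 * |γ|) ^ 2 := by
    rw [hn]
    have : w 0 ^ 2 ≤ |γ| ^ 2 := by rw [← sq_abs (w 0)]; exact pow_le_pow_left₀ (abs_nonneg _) hγ 2
    nlinarith
  exact (pow_le_pow_iff_left₀ (norm_nonneg _) (by positivity) two_ne_zero).1 h2

/-- **The lab-boost map `Ξ(w) = boost(w̃/w⁰)` is smooth on the open set
`{w⁰ ≠ 0, ‖w̃/w⁰‖ < 1}`**, which contains the unit timelike vectors. [folklore] -/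
theorem higherOrder_contDiffOn_labBoost :
    IsOpen ({w : E4 | w 0 ≠ 0} ∩ (fun w : E4 ↦ (w 0)⁻¹ • E4.spatial w) ⁻¹' ball (0 : E3) 1) ∧
    ContDiffOn ℝ ∞ (fun w : E4 ↦ Lorentz.boostCLM ((w 0)⁻¹ • E4.spatial w))
      ({w : E4 | w 0 ≠ 0} ∩ (fun w : E4 ↦ (w 0)⁻¹ • E4.spatial w) ⁻¹' ball (0 : E3) 1) ∧
    (∀ γ : ℝ, {w : E4 | Minkowski.bilin w w = -1 ∧ |w 0| ≤ γ} ⊆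
      {w : E4 | w 0 ≠ 0} ∩ (fun w : E4 ↦ (w 0)⁻¹ • E4.spatial w) ⁻¹' ball (0 : E3) 1) := by
  have hO0 : IsOpen {w : E4 | w 0 ≠ 0} :=
    isOpen_ne_fun (EuclideanSpace.proj (0 : Fin 4)).continuous continuous_const
  have hψ : ContDiffOn ℝ ∞ (fun w : E4 ↦ (w 0)⁻¹ • E4.spatial w) {w : E4 | w 0 ≠ 0} :=
    fun w hw ↦ (contDiffAt_labVelocityMap hw).contDiffWithinAt
  have hopen : IsOpen ({w : E4 | w 0 ≠ 0} ∩ (fun w : E4 ↦ (w 0)⁻¹ • E4.spatial w) ⁻¹' ball (0 : E3) 1) :=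
    hψ.continuousOn.isOpen_inter_preimage hO0 isOpen_ball
  refine ⟨hopen, ?_, fun γ w hw ↦ ?_⟩
  · refine contDiffOn_boostCLM.comp (hψ.mono inter_subset_left) fun w hw ↦ hw.2
  · obtain ⟨-, h2, h3⟩ := higherOrder_unitTimelike_facts hw.1
    exact ⟨h2, by simpa using h3⟩

/-- The time component of a painted `4`-velocity keeps its sign along a continuous path
(`|u⁰| ≥ 1` and the intermediate value theorem). [folklore] -/
theorem higherOrder_sign_constant {u : ℝ → E4} (hu : Continuous u) (h1 : ∀ t, 1 ≤ |u t 0|) :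
    (∀ t, 0 < u t 0) ∨ (∀ t, u t 0 < 0) := by
  have hf : Continuous fun t ↦ u t 0 := (EuclideanSpace.proj (0 : Fin 4)).continuous.comp hu
  have hne : ∀ t, u t 0 ≠ 0 := fun t h ↦ by
    have := h1 t; rw [h, abs_zero] at this; exact absurd this (by norm_num)
  by_cases h0 : 0 < u 0 0
  · left
    intro t
    by_contra hle
    push Not at hle
    have hlt : u t 0 < 0 := lt_of_le_of_ne hle (hne t)
    obtain ⟨s, hs⟩ := intermediate_value_univ t 0 (f := fun t ↦ u t 0) hf ⟨hlt.le, h0.le⟩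
    exact hne s hs
  · right
    have h0' : u 0 0 < 0 := lt_of_le_of_ne (not_lt.1 h0) (hne 0)
    intro t
    by_contra hle
    push Not at hle
    have hlt : 0 < u t 0 := lt_of_le_of_ne hle (fun h ↦ hne t h.symm)
    obtain ⟨s, hs⟩ := intermediate_value_univ 0 t (f := fun t ↦ u t 0) hf ⟨h0'.le, hlt.le⟩
    exact hne s hs

set_option maxHeartbeats 3200000 in
/-- **The pure-boost frame of a non-rotating hole, quantitatively.** For a smooth Lorentz path
`Λ` with Lorentz factor `≤ γ` there are a smooth Lorentz path `Λ̃` and `K ≥ 0` such that `Λ̃`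
paints the same SCHWARZSCHILD field (`a = 0`, all centres and masses), `Λ̃e₀ = Λe₀ = u`, and
at every time `‖Λ̃′‖ ≤ K‖u′‖`, `‖Λ̃″‖ ≤ K(‖u″‖ + ‖u′‖²)`, `‖Λ̃‴‖ ≤ K(‖u‴‖ + ‖u″‖‖u′‖ + ‖u′‖³)`.
[folklore] -/
theorem higherOrder_exists_boostFrame (Λ : ℝ → lorentzGroup) {γ : ℝ}
    (hΛ : ContDiff ℝ ∞ (fun t ↦ ((Λ t : E4 ≃L[ℝ] E4) : E4 →L[ℝ] E4)))
    (hγ : ∀ t, |((Λ t : E4 ≃L[ℝ] E4) (E4.basisVector 0)) 0| ≤ γ) :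
    ∃ (Λ' : ℝ → lorentzGroup) (K : ℝ), 0 ≤ K ∧
      ContDiff ℝ ∞ (fun t ↦ ((Λ' t : E4 ≃L[ℝ] E4) : E4 →L[ℝ] E4)) ∧
      (∀ t c M z, boostedKerrBilin (Λ' t) c M 0 z = boostedKerrBilin (Λ t) c M 0 z) ∧
      (∀ t, (Λ' t : E4 ≃L[ℝ] E4) (E4.basisVector 0) = (Λ t : E4 ≃L[ℝ] E4) (E4.basisVector 0)) ∧
      ∀ t, ‖iteratedDeriv 1 (fun s ↦ ((Λ' s : E4 ≃L[ℝ] E4) : E4 →L[ℝ] E4)) t‖ ≤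
          K * ‖iteratedDeriv 1 (fun s ↦ (Λ s : E4 ≃L[ℝ] E4) (E4.basisVector 0)) t‖ ∧
        ‖iteratedDeriv 2 (fun s ↦ ((Λ' s : E4 ≃L[ℝ] E4) : E4 →L[ℝ] E4)) t‖ ≤
          K * (‖iteratedDeriv 2 (fun s ↦ (Λ s : E4 ≃L[ℝ] E4) (E4.basisVector 0)) t‖ +
            ‖iteratedDeriv 1 (fun s ↦ (Λ s : E4 ≃L[ℝ] E4) (E4.basisVector 0)) t‖ ^ 2) ∧
        ‖iteratedDeriv 3 (fun s ↦ ((Λ' s : E4 ≃L[ℝ] E4) : E4 →L[ℝ] E4)) t‖ ≤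
          K * (‖iteratedDeriv 3 (fun s ↦ (Λ s : E4 ≃L[ℝ] E4) (E4.basisVector 0)) t‖ +
            ‖iteratedDeriv 2 (fun s ↦ (Λ s : E4 ≃L[ℝ] E4) (E4.basisVector 0)) t‖ *
              ‖iteratedDeriv 1 (fun s ↦ (Λ s : E4 ≃L[ℝ] E4) (E4.basisVector 0)) t‖ +
            ‖iteratedDeriv 1 (fun s ↦ (Λ s : E4 ≃L[ℝ] E4) (E4.basisVector 0)) t‖ ^ 3) := by
  -- the painted `4`-velocity, the lab velocity and the lab-boost map
  set u : ℝ → E4 := fun t ↦ (Λ t : E4 ≃L[ℝ] E4) (E4.basisVector 0) with hudef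
  have hus : ContDiff ℝ ∞ u := hΛ.clm_apply contDiff_const
  set O : Set E4 := {w : E4 | w 0 ≠ 0} ∩ (fun w : E4 ↦ (w 0)⁻¹ • E4.spatial w) ⁻¹' ball (0 : E3) 1
    with hO
  set Ξ : E4 → E4 →L[ℝ] E4 := fun w : E4 ↦ Lorentz.boostCLM ((w 0)⁻¹ • E4.spatial w) with hΞ
  obtain ⟨hOo, hΞc, hKO⟩ := higherOrder_contDiffOn_labBoost
  set Kc : Set E4 := {w : E4 | Minkowski.bilin w w = -1 ∧ |w 0| ≤ γ} with hKc
  have hmem : ∀ t, u t ∈ Kc := fun t ↦ by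
    refine ⟨?_, hγ t⟩
    show Minkowski.bilin ((Λ t : E4 ≃L[ℝ] E4) (E4.basisVector 0))
      ((Λ t : E4 ≃L[ℝ] E4) (E4.basisVector 0)) = -1
    rw [(Λ t).2, Minkowski.bilin_basisVector_zero]
  obtain ⟨C, hC0, hC⟩ := exists_forall_norm_iteratedFDeriv_le_of_isCompact hOo hΞc
    (higherOrder_isCompact_unitTimelike γ) (hKO γ) 3
  -- sizes along the path
  have h1 : ∀ t, 1 ≤ |u t 0| := fun t ↦ one_le_abs_lorentz_apply_zero (Λ t)
  have hu0 : ∀ t, u t 0 ≠ 0 := fun t h ↦ by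
    have := h1 t; rw [h, abs_zero] at this; exact absurd this (by norm_num)
  set v : ℝ → E3 := fun t ↦ (u t 0)⁻¹ • E4.spatial (u t) with hvdef
  have hv : ∀ t, ‖v t‖ < 1 := fun t ↦ (higherOrder_unitTimelike_facts (hmem t).1).2.2
  -- the composite `Ξ ∘ u` and its derivative bounds
  have hΞu : ContDiff ℝ ∞ (Ξ ∘ u) := hΞc.comp_contDiff hus fun t ↦ hKO γ (hmem t)
  have hbd : ∀ t, ‖deriv (Ξ ∘ u) t‖ ≤ C * ‖deriv u t‖ ∧
      ‖iteratedDeriv 2 (Ξ ∘ u) t‖ ≤ C * (‖iteratedDeriv 2 u t‖ + ‖deriv u t‖ ^ 2) ∧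
      ‖iteratedDeriv 3 (Ξ ∘ u) t‖ ≤
        C * (‖iteratedDeriv 3 u t‖ + 3 * ‖iteratedDeriv 2 u t‖ * ‖deriv u t‖ + ‖deriv u t‖ ^ 3) := by
    intro t
    have h := higherOrder_norm_deriv_comp₃_le hOo hΞc hus (hKO γ (hmem t))
      (hC (u t) (hmem t) 1 (by norm_num)) (hC (u t) (hmem t) 2 (by norm_num))
      (hC (u t) (hmem t) 3 le_rfl)
    exact ⟨h.1, h.2.2.2.1, h.2.2.2.2⟩
  have hbd' : ∀ t, ‖iteratedDeriv 1 (Ξ ∘ u) t‖ ≤ (3 * C) * ‖iteratedDeriv 1 u t‖ ∧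
      ‖iteratedDeriv 2 (Ξ ∘ u) t‖ ≤ (3 * C) * (‖iteratedDeriv 2 u t‖ + ‖iteratedDeriv 1 u t‖ ^ 2) ∧
      ‖iteratedDeriv 3 (Ξ ∘ u) t‖ ≤ (3 * C) * (‖iteratedDeriv 3 u t‖ +
        ‖iteratedDeriv 2 u t‖ * ‖iteratedDeriv 1 u t‖ + ‖iteratedDeriv 1 u t‖ ^ 3) := by
    intro t
    obtain ⟨b1, b2, b3⟩ := hbd t
    simp only [iteratedDeriv_one]
    have hp1 : 0 ≤ ‖deriv u t‖ := norm_nonneg _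
    have hp2 : 0 ≤ ‖iteratedDeriv 2 u t‖ := norm_nonneg _
    have hp3 : 0 ≤ ‖iteratedDeriv 3 u t‖ := norm_nonneg _
    refine ⟨b1.trans ?_, b2.trans ?_, b3.trans ?_⟩
    · have : 0 ≤ 2 * (C * ‖deriv u t‖) := by positivity
      linarith only [this]
    · have : 0 ≤ 2 * (C * (‖iteratedDeriv 2 u t‖ + ‖deriv u t‖ ^ 2)) := by positivity
      linarith only [this]
    · have : 0 ≤ 2 * (C * ‖iteratedDeriv 3 u t‖) + 2 * (C * ‖deriv u t‖ ^ 3) := by positivity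
      nlinarith only [this, hC0, hp1, hp2, hp3]
  -- the boost reproduces `u` up to sign
  have hbu : ∀ t, (Lorentz.boost (v t) (hv t) : E4 ≃L[ℝ] E4) (E4.basisVector 0) =
      (|u t 0| * (u t 0)⁻¹) • u t := fun t ↦ boost_labVelocity_apply_basisVector_zero (Λ t) (hv t)
  rcases higherOrder_sign_constant hus.continuous h1 with hpos | hneg
  · -- orthochronous case: the pure boost
    have hbu' : ∀ t, (Lorentz.boost (v t) (hv t) : E4 ≃L[ℝ] E4) (E4.basisVector 0) = u t := fun t ↦ by
      rw [hbu t, abs_of_pos (hpos t), mul_inv_cancel₀ (hu0 t), one_smul]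
    have hcoe : (fun t ↦ ((Lorentz.boost (v t) (hv t) : E4 ≃L[ℝ] E4) : E4 →L[ℝ] E4)) = Ξ ∘ u := by
      funext t; ext w; rfl
    refine ⟨fun t ↦ Lorentz.boost (v t) (hv t), 3 * C, by positivity, by rw [hcoe]; exact hΞu,
      fun t c M z ↦ ?_, hbu', fun t ↦ ?_⟩
    · ext V W
      rw [boostedKerrBilin_zero_spin_eq_boost_repr (Λ t) (hv t) (hbu' t) M c z V W,
        boostedKerrBilin_zero_spin_eq_boost_repr (Lorentz.boost (v t) (hv t)) (hv t) rfl M c z V W]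
    · rw [hcoe]; exact hbd' t
  · -- time-reversing case: boost composed with the time reflection
    obtain ⟨T, hT⟩ := higherOrder_exists_timeReflect
    have hT0 : (T : E4 ≃L[ℝ] E4) (E4.basisVector 0) = -E4.basisVector 0 := by
      rw [hT]
      have : (E4.basisVector 0 : E4) 0 = 1 := by simp [E4.basisVector]
      rw [this, mul_one, two_smul]; abel
    have hbu' : ∀ t, (Lorentz.boost (v t) (hv t) : E4 ≃L[ℝ] E4) (E4.basisVector 0) = -u t := fun t ↦ by
      rw [hbu t, abs_of_neg (hneg t), neg_mul, mul_inv_cancel₀ (hu0 t), neg_smul, one_smul]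
    have hcol : ∀ t, ((Lorentz.boost (v t) (hv t) * T : lorentzGroup) : E4 ≃L[ℝ] E4) (E4.basisVector 0) =
        u t := fun t ↦ by
      show (Lorentz.boost (v t) (hv t) : E4 ≃L[ℝ] E4) ((T : E4 ≃L[ℝ] E4) (E4.basisVector 0)) = u t
      rw [hT0, map_neg, hbu', neg_neg]
    set Tc : E4 →L[ℝ] E4 := ((T : E4 ≃L[ℝ] E4) : E4 →L[ℝ] E4) with hTc
    have hcoe : (fun t ↦ (((Lorentz.boost (v t) (hv t) * T : lorentzGroup) : E4 ≃L[ℝ] E4) : E4 →L[ℝ] E4)) =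
        fun t ↦ ((Ξ ∘ u) t).comp Tc := by
      funext t; ext w; rfl
    have hTn : ‖Tc‖ ≤ 3 := by
      refine ContinuousLinearMap.opNorm_le_bound _ (by norm_num) fun w ↦ ?_
      have hw : Tc w = w - (2 * w 0) • E4.basisVector 0 := hT w
      rw [hw]
      have h0 : |w 0| ≤ ‖w‖ := by rw [← Real.norm_eq_abs]; exact PiLp.norm_apply_le w 0
      have he : ‖(E4.basisVector 0 : E4)‖ = 1 := by simp
      calc ‖w - (2 * w 0) • E4.basisVector 0‖ ≤ ‖w‖ + ‖(2 * w 0) • (E4.basisVector 0 : E4)‖ :=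
            norm_sub_le _ _
        _ = ‖w‖ + 2 * |w 0| := by rw [norm_smul, he, mul_one, Real.norm_eq_abs, abs_mul, abs_two]
        _ ≤ 3 * ‖w‖ := by linarith
    set L : (E4 →L[ℝ] E4) →L[ℝ] (E4 →L[ℝ] E4) := (ContinuousLinearMap.compL ℝ E4 E4 E4).flip Tc with hL
    have hLapp : ∀ A : E4 →L[ℝ] E4, L A = A.comp Tc := fun A ↦ rfl
    have hiter : ∀ (k : ℕ) (t : ℝ), iteratedDeriv k (fun s ↦ ((Ξ ∘ u) s).comp Tc) t =
        (iteratedDeriv k (Ξ ∘ u) t).comp Tc := by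
      intro k t
      have h := iteratedDeriv_clm_comp L hΞu k t
      simpa only [hLapp] using h
    have hnk : ∀ (k : ℕ) (t : ℝ), ‖iteratedDeriv k (fun s ↦ ((Ξ ∘ u) s).comp Tc) t‖ ≤
        3 * ‖iteratedDeriv k (Ξ ∘ u) t‖ := fun k t ↦ by
      rw [hiter]
      calc _ ≤ ‖iteratedDeriv k (Ξ ∘ u) t‖ * ‖Tc‖ := ContinuousLinearMap.opNorm_comp_le _ _
        _ ≤ ‖iteratedDeriv k (Ξ ∘ u) t‖ * 3 := by gcongr
        _ = 3 * ‖iteratedDeriv k (Ξ ∘ u) t‖ := by ring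
    refine ⟨fun t ↦ Lorentz.boost (v t) (hv t) * T, 3 * (3 * C), by positivity, ?_,
      fun t c M z ↦ ?_, hcol, fun t ↦ ?_⟩
    · rw [hcoe]; exact hΞu.clm_comp contDiff_const
    · have hneg' : (Lorentz.boost (v t) (hv t) : E4 ≃L[ℝ] E4) (E4.basisVector 0) =
          -((Lorentz.boost (v t) (hv t) * T : lorentzGroup) : E4 ≃L[ℝ] E4) (E4.basisVector 0) := by
        rw [hcol, hbu']
      have hnegΛ : (Lorentz.boost (v t) (hv t) : E4 ≃L[ℝ] E4) (E4.basisVector 0) =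
          -(Λ t : E4 ≃L[ℝ] E4) (E4.basisVector 0) := hbu' t
      ext V W
      rw [boostedKerrBilin_zero_spin_eq_reflect_boost_repr (Λ t) (hv t) hnegΛ M c z V W,
        boostedKerrBilin_zero_spin_eq_reflect_boost_repr _ (hv t) hneg' M c z V W]
    · rw [hcoe]
      obtain ⟨b1, b2, b3⟩ := hbd' t
      refine ⟨(hnk 1 t).trans ?_, (hnk 2 t).trans ?_, (hnk 3 t).trans ?_⟩
      · calc _ ≤ 3 * ((3 * C) * ‖iteratedDeriv 1 u t‖) := by gcongr
          _ = _ := by ring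
      · calc _ ≤ 3 * ((3 * C) * (‖iteratedDeriv 2 u t‖ + ‖iteratedDeriv 1 u t‖ ^ 2)) := by gcongr
          _ = _ := by ring
      · calc _ ≤ 3 * ((3 * C) * (‖iteratedDeriv 3 u t‖ +
            ‖iteratedDeriv 2 u t‖ * ‖iteratedDeriv 1 u t‖ + ‖iteratedDeriv 1 u t‖ ^ 3)) := by gcongr
          _ = _ := by ring

/-- **Registered one-line carrier form** (`higherOrder_boostFrame_EF`) of
`higherOrder_exists_boostFrame`. [folklore] -/
theorem higherOrder_boostFrame_EF : open Literature.Geometry.Lorentzian in ∀ (Λ : ℝ → lorentzGroup) {γ : ℝ}, ContDiff ℝ ((⊤ : ℕ∞) : WithTop ℕ∞) (fun t ↦ ((Λ t : E4 ≃L[ℝ] E4) : E4 →L[ℝ] E4)) → (∀ t, |((Λ t : E4 ≃L[ℝ] E4) (E4.basisVector 0)) 0| ≤ γ) → ∃ (Λ' : ℝ → lorentzGroup) (K : ℝ), 0 ≤ K ∧ ContDiff ℝ ((⊤ : ℕ∞) : WithTop ℕ∞) (fun t ↦ ((Λ' t : E4 ≃L[ℝ] E4) : E4 →L[ℝ] E4))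 ∧ (∀ (t : ℝ) (c : E4) (M : ℝ) (z : E4), boostedKerrBilin (Λ' t) c M 0 z = boostedKerrBilin (Λ t) c M 0 z) ∧ (∀ t, (Λ' t : E4 ≃L[ℝ] E4) (E4.basisVector 0) = (Λ t : E4 ≃L[ℝ] E4) (E4.basisVector 0)) ∧ ∀ t, ‖iteratedDeriv 1 (fun s ↦ ((Λ' s : E4 ≃L[ℝ] E4) : E4 →L[ℝ] E4)) t‖ ≤ K * ‖iteratedDeriv 1 (fun s ↦ (Λ s : E4 ≃L[ℝ] E4) (E4.basisVector 0)) t‖ ∧ ‖iteratedDeriv 2 (fun s ↦ ((Λ' s : E4 ≃L[ℝ] E4) : E4 →L[ℝ] E4)) t‖ ≤ K * (‖iteratedDeriv 2 (fun s ↦ (Λ s : E4 ≃L[ℝ] E4) (E4.basisVector 0)) t‖ + ‖iteratedDeriv 1 (fun s ↦ (Λ s : E4 ≃L[ℝ] E4) (E4.basisVector 0)) t‖ ^ 2) ∧ ‖iteratedDeriv 3 (fun s ↦ ((Λ' s : E4 ≃L[ℝ] E4) : E4 →L[ℝ] E4)) t‖ ≤ K * (‖iteratedDeriv 3 (fun s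 ↦ (Λ s : E4 ≃L[ℝ] E4) (E4.basisVector 0)) t‖ + ‖iteratedDeriv 2 (fun s ↦ (Λ s : E4 ≃L[ℝ] E4) (E4.basisVector 0)) t‖ * ‖iteratedDeriv 1 (fun s ↦ (Λ s : E4 ≃L[ℝ] E4) (E4.basisVector 0)) t‖ + ‖iteratedDeriv 1 (fun s ↦ (Λ s : E4 ≃L[ℝ] E4) (E4.basisVector 0)) t‖ ^ 3) :=
  fun Λ _ hΛ hγ ↦ higherOrder_exists_boostFrame Λ hΛ hγ

end Summit.FinalStateConjecture.FinalStateConjecture.Theorems.SublinearIsFree.Slaving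

end
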